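import Literature.AlgebraicGeometry.Resolution.NormalizationOfVarietiesProofs
import Mathlib.RingTheory.EssentialFiniteness
import Mathlib.RingTheory.Localization.Integral
import Mathlib.RingTheory.Localization.LocalizationLocalization
import HarnessLib

/-!
# Finiteness of the integral closure for domains essentially of finite type over a field

Topic: `Literature/AlgebraicGeometry/Resolution`. Pure commutative algebra serving the last
paragraph of Cossart–Piltant 2019, proof of journal Prop. 4.8 = arXiv v1 Prop. 4.6 (p. 53):

> "Let `T` be the integral closure of `A[g₁, …, g_d]` in `K`. By [EGA IV] corollary 7.7.3,
> `T` is a finitely generated `A`-algebra."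

There `A` is a quasi-excellent local domain (quasi-excellent rings are Nagata, Stacks 07QV); in
the case of the local rings `A = 𝒪_{X,x} = B_𝔭` of schemes of finite type over a field which
the tree's reduction `ArithmeticalThreefoldsClosedPoints.lean` needs, `A[g₁, …, g_d]` is a domain
ESSENTIALLY OF FINITE TYPE over the field, and the finiteness of its integral closure in its own
fraction field is E. Noether's theorem (`NoetherFiniteIntegralClosure_holds`, Liu 2002
Prop. 4.1.27) combined with the compatibility of integral closure with localisation
(Stacks 0307). Everything here is PROVED; no definitions, no named facts:

* `module_finite_integralClosure_of_isLocalization` — if `A = M⁻¹A₀` and the integral closure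
  of `A₀` in a field `K ⊇ A` is finite over `A₀`, then the integral closure of `A` in `K` is
  finite over `A` (every `x` integral over `M⁻¹A₀` has `m x` integral over `A₀` for some
  `m ∈ M`, Mathlib `IsIntegral.exists_multiple_integral_of_isLocalization`);
* `isFractionRing_subalgebra_of_isLocalization` — bookkeeping: `Frac A₀ = Frac A`;
* `module_finite_integralClosure_of_essFiniteType` — **a domain essentially of finite type over
  a field has finite normalisation** (is N-1);
* `essFiniteType_adjoin` — `A[s] ⊆ Frac A` for a finite `s` is again essentially of finite
  type (and it has the same fraction field `K`: this is the Mathlib instance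
  `Localization.subalgebra.instIsFractionRingSubtypeMemSubalgebra` of
  `Mathlib.RingTheory.Localization.AsSubring`, found by `inferInstance`);
* `exists_adjoin_eq_integralClosure_adjoin` — **Cossart–Piltant's `T`**: for `A` a domain
  essentially of finite type over a field with fraction field `K` and a finite `s ⊆ K`, the
  integral closure of `A[s]` in `K` is `A[t]` for a finite `t ⊆ K` (a finitely generated
  `A`-algebra), and it is integrally closed in `K`.

## Sources

* V. Cossart, O. Piltant, J. Algebra 529 (2019) 268–535 = arXiv:1412.0868, end of the proof of
  Prop. 4.8 (arXiv v1: Prop. 4.6, p. 53). [CossartPiltant2019]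
* Q. Liu, *Algebraic Geometry and Arithmetic Curves* (2002), Prop. 4.1.27. [Liu2002]
* The Stacks Project, Tag 0307 (integral closure commutes with localisation), Tag 07QV.
  [StacksProject]
-/

noncomputable section

namespace Literature.AlgebraicGeometry.Resolution

universe u

/-! ## Integral closure and localisation -/

section Localization

variable {A₀ A K : Type u} [CommRing A₀] [CommRing A] [Algebra A₀ A] [Field K] [Algebra A₀ K]
  [Algebra A K] [IsScalarTower A₀ A K]

/-- **Finiteness of the integral closure passes to localisations** (Stacks 0307: integral
closure commutes with localisation): if `A = M⁻¹A₀` inside a field `K` and the integral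
closure of `A₀` in `K` is a finite `A₀`-module, then the integral closure of `A` in `K` is a
finite `A`-module, generated by the same elements — for `x ∈ K` integral over `M⁻¹A₀` some
`m x`, `m ∈ M`, is integral over `A₀`. [cite: StacksProject, Tag 0307] -/
theorem module_finite_integralClosure_of_isLocalization (M : Submonoid A₀) [IsLocalization M A]
    (h : Module.Finite A₀ (integralClosure A₀ K)) : Module.Finite A (integralClosure A K) := by
  classical
  obtain ⟨s, hs⟩ := Module.finite_def.mp h
  -- the generators, seen in the integral closure of `A`
  let φ : integralClosure A₀ K → integralClosure A K := fun c => ⟨(c : K), c.2.tower_top⟩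
  refine Module.finite_def.mpr ⟨s.image φ, ?_⟩
  rw [_root_.eq_top_iff]
  rintro x -
  -- `m • x` is integral over `A₀` for some `m ∈ M`
  obtain ⟨m, hm⟩ := IsIntegral.exists_multiple_integral_of_isLocalization M (x : K) x.2
  set y : integralClosure A₀ K := ⟨(m : A₀) • (x : K), hm⟩ with hy
  have hy_span : y ∈ Submodule.span A₀ (s : Set (integralClosure A₀ K)) := by
    rw [hs]; exact Submodule.mem_top
  -- push the `A₀`-linear combination through `φ`
  have hφ_span : ∀ z ∈ Submodule.span A₀ (s : Set (integralClosure A₀ K)),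
      φ z ∈ Submodule.span A ((s.image φ : Finset _) : Set (integralClosure A K)) := by
    intro z hz
    refine Submodule.span_induction (p := fun z _ => φ z ∈ Submodule.span A
      ((s.image φ : Finset _) : Set (integralClosure A K))) ?_ ?_ ?_ ?_ hz
    · intro c hc
      exact Submodule.subset_span (by
        rw [Finset.coe_image]
        exact Set.mem_image_of_mem φ hc)
    · have : φ 0 = 0 := Subtype.ext rfl
      rw [this]; exact zero_mem _
    · intro a b _ _ ha hb
      have : φ (a + b) = φ a + φ b := Subtype.ext rfl
      rw [this]; exact add_mem ha hb
    · intro r a _ ha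
      have : φ (r • a) = algebraMap A₀ A r • φ a := by
        apply Subtype.ext
        change ((r • a : integralClosure A₀ K) : K) = algebraMap A₀ A r • (a : K)
        rw [Subalgebra.coe_smul, algebraMap_smul]
      rw [this]; exact Submodule.smul_mem _ _ ha
  have hφy : φ y ∈ Submodule.span A ((s.image φ : Finset _) : Set (integralClosure A K)) :=
    hφ_span y hy_span
  -- `x = m⁻¹ • φ y`
  obtain ⟨u, hu⟩ := IsLocalization.map_units A m
  have hx : x = ((u⁻¹ : Aˣ) : A) • φ y := by
    apply Subtype.ext
    change (x : K) = ((u⁻¹ : Aˣ) : A) • ((m : A₀) • (x : K))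
    rw [← algebraMap_smul A (m : A₀) (x : K), smul_smul, ← hu, Units.inv_mul, one_smul]
  rw [hx]
  exact Submodule.smul_mem _ _ hφy

end Localization

/-! ## Domains essentially of finite type over a field -/

section EssFiniteType

variable (k A K : Type u) [Field k] [CommRing A] [IsDomain A] [Algebra k A] [Field K]
  [Algebra A K] [IsFractionRing A K]

/-- For `A` essentially of finite type over `k`, a domain with fraction field `K`, the finite
type subalgebra `A₀ ⊆ A` of which `A` is a localisation also has fraction field `K`.
[folklore] -/
theorem isFractionRing_subalgebra_of_isLocalization [Algebra.EssFiniteType k A] :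
    IsFractionRing (Algebra.EssFiniteType.subalgebra k A) K := by
  set A₀ := Algebra.EssFiniteType.subalgebra k A
  -- `A₀ ⊆ A` acts on `K` through `A`
  have hA₀K : ∀ x : A₀, algebraMap A₀ K x = algebraMap A K (x : A) := fun _ => rfl
  haveI : IsScalarTower A₀ A K := IsScalarTower.of_algebraMap_eq fun x => hA₀K x
  have hinj : Function.Injective (algebraMap A₀ K) := by
    intro x y hxy
    rw [hA₀K, hA₀K] at hxy
    exact Subtype.ext (IsFractionRing.injective A K hxy)
  haveI : FaithfulSMul A₀ K := (faithfulSMul_iff_algebraMap_injective _ _).mpr hinj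
  refine IsFractionRing.of_field A₀ K fun z => ?_
  obtain ⟨a, b, hb, rfl⟩ := IsFractionRing.div_surjective (A := A) z
  obtain ⟨⟨a₀, ma⟩, ha⟩ := IsLocalization.surj (Algebra.EssFiniteType.submonoid k A) a
  obtain ⟨⟨b₀, mb⟩, hb'⟩ := IsLocalization.surj (Algebra.EssFiniteType.submonoid k A) b
  -- `a = a₀/ma`, `b = b₀/mb`, so `a/b = (a₀ mb)/(b₀ ma)`
  have ha' : ((a₀ : A₀) : A) = a * ((ma : A₀) : A) := ha.symm
  have hb'' : ((b₀ : A₀) : A) = b * ((mb : A₀) : A) := hb'.symm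
  have hmaK : algebraMap A K ((ma : A₀) : A) ≠ 0 :=
    (map_ne_zero_iff _ (IsFractionRing.injective A K)).mpr (IsLocalization.map_units A ma).ne_zero
  have hmbK : algebraMap A K ((mb : A₀) : A) ≠ 0 :=
    (map_ne_zero_iff _ (IsFractionRing.injective A K)).mpr (IsLocalization.map_units A mb).ne_zero
  have hbK : algebraMap A K b ≠ 0 :=
    (map_ne_zero_iff _ (IsFractionRing.injective A K)).mpr (nonZeroDivisors.ne_zero hb)
  refine ⟨a₀ * mb, b₀ * ma, ?_⟩
  rw [hA₀K, hA₀K, Subalgebra.coe_mul, Subalgebra.coe_mul, ha', hb'', map_mul, map_mul, map_mul,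
    map_mul, div_eq_div_iff hbK (mul_ne_zero (mul_ne_zero hbK hmbK) hmaK)]
  ring

/-- **A domain essentially of finite type over a field has finite normalisation** (it is N-1;
EGA IV 7.7.3 as used by Cossart–Piltant, here from E. Noether's finiteness theorem, Liu 2002
Prop. 4.1.27 = `NoetherFiniteIntegralClosure_holds`, and localisation, Stacks 0307): the
integral closure of `A` in `K = Frac A` is a finite `A`-module.
[cite: Liu2002, Prop. 4.1.27, p. 122] [cite: StacksProject, Tag 0307] -/
theorem module_finite_integralClosure_of_essFiniteType [Algebra.EssFiniteType k A] :
    Module.Finite A (integralClosure A K) := by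
  set A₀ := Algebra.EssFiniteType.subalgebra k A
  haveI : IsScalarTower A₀ A K := IsScalarTower.of_algebraMap_eq fun _ => rfl
  haveI : IsFractionRing A₀ K := isFractionRing_subalgebra_of_isLocalization k A K
  haveI : IsScalarTower A₀ K K := IsScalarTower.right
  have h₀ : Module.Finite A₀ (integralClosure A₀ K) :=
    NoetherFiniteIntegralClosure_holds k A₀ K K
  exact module_finite_integralClosure_of_isLocalization (Algebra.EssFiniteType.submonoid k A) h₀

variable {k A K}

omit [IsDomain A] [IsFractionRing A K] in
/-- `A[s]` is essentially of finite type over `k` when `A` is and `s` is finite. [folklore] -/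
theorem essFiniteType_adjoin [Algebra k K] [IsScalarTower k A K] [Algebra.EssFiniteType k A]
    (s : Finset K) : Algebra.EssFiniteType k (Algebra.adjoin A (s : Set K)) := by
  haveI : Algebra.FiniteType A (Algebra.adjoin A (s : Set K)) :=
    (Subalgebra.fg_iff_finiteType _).mp (Subalgebra.fg_adjoin_finset s)
  exact Algebra.EssFiniteType.comp k A (Algebra.adjoin A (s : Set K))

omit [IsDomain A] [IsFractionRing A K] in
/-- Elements of a subalgebra `B ⊆ K` are integral over `B`. [folklore] -/
theorem isIntegral_of_mem_subalgebra (B : Subalgebra A K) {x : K} (hx : x ∈ B) :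
    IsIntegral B x :=
  (isIntegral_algebraMap (R := B) (A := K) (x := ⟨x, hx⟩))

omit [IsDomain A] in
/-- **Cossart–Piltant's `T`** ("Let `T` be the integral closure of `A[g₁, …, g_d]` in `K`. By
[EGA IV] corollary 7.7.3, `T` is a finitely generated `A`-algebra", proof of Prop. 4.8): for a
domain `A` essentially of finite type over a field `k` with fraction field `K` and a finite
`s ⊆ K`, there is a finite `t ⊇ s` in `K` such that `A[t]` is exactly the set of elements of `K`
integral over `A[s]`; in particular `A[t]` is a finitely generated `A`-algebra, integral over
`A[s]` and integrally closed in `K`. (`A[s]` is a domain essentially of finite type over `k` with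
fraction field `K`, so its integral closure is finite over it,
`module_finite_integralClosure_of_essFiniteType`; take for `t` the union of `s` and module
generators.) [cite: CossartPiltant2019, end of proof of Prop. 4.8 (arXiv v1: Prop. 4.6, p. 53)]
[cite: Liu2002, Prop. 4.1.27, p. 122] -/
theorem exists_adjoin_eq_integralClosure_adjoin [Algebra k K] [IsScalarTower k A K]
    [Algebra.EssFiniteType k A] (s : Finset K) :
    ∃ t : Finset K, s ⊆ t ∧
      (∀ x : K, x ∈ Algebra.adjoin A (t : Set K) ↔ IsIntegral (Algebra.adjoin A (s : Set K)) x) ∧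
      (∀ x : K, IsIntegral (Algebra.adjoin A (t : Set K)) x → x ∈ Algebra.adjoin A (t : Set K)) := by
  classical
  set B : Subalgebra A K := Algebra.adjoin A (s : Set K) with hBdef
  -- `Frac B = K`: Mathlib instance `Localization.subalgebra.instIsFractionRingSubtypeMemSubalgebra`
  haveI : IsFractionRing B K := inferInstance
  haveI : Algebra.EssFiniteType k B := essFiniteType_adjoin s
  haveI : IsScalarTower A B K := IsScalarTower.of_algebraMap_eq fun _ => rfl
  have hfin : Module.Finite B (integralClosure B K) :=
    module_finite_integralClosure_of_essFiniteType k B K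
  obtain ⟨g, hg⟩ := Module.finite_def.mp hfin
  let t : Finset K := s ∪ g.image (fun c : integralClosure B K => (c : K))
  have hst : s ⊆ t := Finset.subset_union_left
  have hBt : B ≤ Algebra.adjoin A (t : Set K) := Algebra.adjoin_mono (by exact_mod_cast hst)
  -- `A[t] ⊆` integral closure of `B`
  have hsub : ∀ x : K, x ∈ Algebra.adjoin A (t : Set K) → IsIntegral B x := by
    intro x hx
    have hle : Algebra.adjoin A (t : Set K) ≤ (integralClosure B K).restrictScalars A := by
      rw [Algebra.adjoin_le_iff]
      intro y hy
      rw [Finset.mem_coe, Finset.mem_union] at hy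
      change IsIntegral B y
      rcases hy with hy | hy
      · exact isIntegral_of_mem_subalgebra B (Algebra.subset_adjoin (Finset.mem_coe.mpr hy))
      · obtain ⟨c, -, rfl⟩ := Finset.mem_image.mp hy
        exact c.2
    exact hle hx
  -- integral closure of `B` `⊆ A[t]`
  have hsup : ∀ x : K, IsIntegral B x → x ∈ Algebra.adjoin A (t : Set K) := by
    intro x hx
    have hmem : (⟨x, hx⟩ : integralClosure B K) ∈ Submodule.span B (g : Set (integralClosure B K)) := by
      rw [hg]; exact Submodule.mem_top
    suffices h : ∀ z ∈ Submodule.span B (g : Set (integralClosure B K)),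
        (z : K) ∈ Algebra.adjoin A (t : Set K) from h _ hmem
    intro z hz
    refine Submodule.span_induction
      (p := fun (z : integralClosure B K) _ => (z : K) ∈ Algebra.adjoin A (t : Set K))
      ?_ ?_ ?_ ?_ hz
    · intro c hc
      apply Algebra.subset_adjoin
      rw [Finset.mem_coe, Finset.mem_union]
      exact Or.inr (Finset.mem_image.mpr ⟨c, hc, rfl⟩)
    · exact zero_mem _
    · intro a b _ _ ha hb
      rw [Subalgebra.coe_add]
      exact add_mem ha hb
    · intro r a _ ha
      have : ((r • a : integralClosure B K) : K) = (r : K) * (a : K) := rfl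
      rw [this]
      exact mul_mem (hBt r.2) ha
  refine ⟨t, hst, fun x => ⟨hsub x, hsup x⟩, fun x hx => ?_⟩
  -- `A[t]` is integrally closed in `K`: it is integral over `B`
  set T : Subalgebra A K := Algebra.adjoin A (t : Set K) with hTdef
  letI : Algebra B T := (Subalgebra.inclusion hBt).toRingHom.toAlgebra
  haveI : IsScalarTower B T K := IsScalarTower.of_algebraMap_eq fun _ => rfl
  have hinjT : Function.Injective (IsScalarTower.toAlgHom B T K) := fun a b hab =>
    Subtype.ext hab
  haveI : Algebra.IsIntegral B T := ⟨fun y =>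
    (isIntegral_algHom_iff (IsScalarTower.toAlgHom B T K) hinjT).mp (hsub (y : K) y.2)⟩
  exact hsup x (isIntegral_trans (R := B) (A := T) x hx)

end EssFiniteType

end Literature.AlgebraicGeometry.Resolution
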